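import Literature.AlgebraicGeometry.Frobenioids.ArchimedeanProp35iiCounterexample
import Literature.AlgebraicGeometry.Frobenioids.ArchimedeanNotIsoSubanchorAngular
import HarnessLib

/-!
# Frobenioids II, Proposition 3.5 (ii) for the ANGULAR Frobenioid `A` WITHOUT the standing hypothesis
# «`D` totally epimorphic»: the same retract base refutes the typed instance `ArchFrd.Prop35ii_A`

Mochizuki, *The geometry of Frobenioids II: poly-Frobenioids*, Kyushu J. Math. **62** (2008) 401–460, §3,
Prop. 3.5 (ii), kurims p. 34 [cite: MochizukiFrdII2008, Prop 3.5 (ii) p.34] ("The Frobenioid `F` is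
quasi-isotropic, i.e., an object of `F` is non-isotropic if and only if it is an iso-subanchor of `F`"), for
`F = A ⊆ C` the angular Frobenioid of Example 3.3 (iii), p. 29 (the wide subcategory of isometries), over a base
`D → D₀` which Ex. 3.3 (i), p. 28, assumes "connected, **totally epimorphic**" and of RC-iso-subanchor type.

The typed instance `ArchFrd.Prop35ii_A π` (FACT-LIST row F-0861) omits "totally epimorphic"; it is PROVED under
that hypothesis (`ArchFrd.prop35ii_A (hTE)`, `ArchimedeanQuasiIsotropic.lean`) and outright at the base of
[IUTchI] Ex. 3.4 (`prop35ii_A_ptBase`). Over the retract base `RB → D₀` of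
`ArchimedeanProp35iiCounterexample.lean` (a point `pt` and a two-point set `two`, all maps, constant functor at
`Spec ℂ`; connected, of RC-iso-subanchor type, NOT totally epimorphic) it FAILS: the arrows `(id, r)`,
`(φ₀, s ≫ φ_D)`, `(id, s)`, `(id, τ)` of the `C`-argument are ISOMETRIES, factorizations / monomorphisms /
invariance in `A` are read in `C`, and an arrow of `A` invertible in `C` is invertible in `A`
(`A.isIso_of_isIso_val`); so the tip-`1` ISOTROPIC object over `pt` is an ISO-SUBANCHOR of `A`
(`A.isIsoSubanchor_unit`) — `not_prop35ii_A_retract`, `exists_base_not_prop35ii_A`.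

FACT-LIST: the universal closure of row F-0861 is REFUTED; the printed item WITH its standing hypothesis is
PROVED (`ArchFrd.prop35ii_A`). No claim of the paper is contradicted. Nothing here bears on [IUTchIII]. -/

namespace Literature.AlgebraicGeometry.Frobenioids

open CategoryTheory

noncomputable section
namespace ArchFrd

open RB

namespace A

/-- `U d` as an object of the angular Frobenioid `A ⊆ C`. [cite: MochizukiFrdII2008, Ex 3.3 (iii) p.29] -/
abbrev UA (d : RB) : A πR := ⟨U d⟩

/-- `(id, g) : U d → U d'` is an isometry (its `C₀`-component is an identity), i.e. an arrow of `A`.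
[cite: MochizukiFrdII2008, Ex 3.3 (iii) p.29] -/
def uHomA {d d' : RB} (g : d ⟶ d') : UA d ⟶ UA d' :=
  ⟨uHom g, by
    have h : PreFrobenioid.IsIsometry C0.toElem (uHom g).fst :=
      (PreFrobenioid.isometricMorphisms C0.toElem).id_mem _
    exact h⟩

/-- The second factor `(φ₀, g₂)` of the canonical factorization, in `A` (same `C₀`-component as `φ`, hence
an isometry). [cite: MochizukiFrdII2008, Ex 3.3 (iii) p.29] -/
def liftA {Y : A πR} (φ : UA pt ⟶ Y) (g₂ : two ⟶ Y.obj.snd) : UA two ⟶ Y :=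
  ⟨lift₂ φ.1 g₂, φ.2⟩

/-- Every arrow of `A` out of the object over `pt` factors as `(id, r) ≫ (φ₀, s ≫ φ_D)`.
[cite: MochizukiFrdII2008, Ex 3.3 (iii) p.29] -/
theorem fac_of_over_pt {Y : A πR} (φ : UA pt ⟶ Y) : uHomA r ≫ liftA φ (s ≫ φ.1.snd) = φ :=
  WideSubcategory.hom_ext _ (ArchFrd.fac_of_over_pt φ.1)

/-- No arrow of `A` out of the object over `pt` is irreducible (both factors have non-invertible
`RB`-component). [cite: MochizukiFrdI2008, §0 p.18] -/
theorem not_isIrreducibleHom_of_over_pt {Y : A πR} (φ : UA pt ⟶ Y) : ¬ IsIrreducibleHom φ := by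
  rintro ⟨-, hfac⟩
  rcases hfac (uHomA r) (liftA φ (s ≫ φ.1.snd)) (fac_of_over_pt φ) with hα | hβ
  · haveI := hα
    haveI : IsIso (lift₂ φ.1 (s ≫ φ.1.snd)) :=
      (inferInstance : IsIso ((A.ι πR).map (liftA φ (s ≫ φ.1.snd))))
    exact not_isIso_s_comp φ.1.snd (CFP.isIso_snd (lift₂ φ.1 (s ≫ φ.1.snd)))
  · haveI := hβ
    haveI : IsIso (uHom r) := (inferInstance : IsIso ((A.ι πR).map (uHomA r)))
    exact not_isIso_from_pt r (CFP.isIso_snd (uHom r))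

/-- **The object over `pt` is an ANCHOR of `A`** (no irreducible arrow leaves it). [cite: MochizukiFrdI2008, §0 p.18] -/
theorem isAnchor_unit : IsAnchor (UA pt) := by
  refine Set.Finite.subset Set.finite_empty ?_
  rintro x ⟨f, hf, -⟩
  exact (not_isIrreducibleHom_of_over_pt f.hom hf).elim

/-- The swap `(id, τ)` as an automorphism of the object of `A` over `two`. [cite: MochizukiFrdII2008, Ex 3.3 (iii) p.29] -/
def TA : UA two ≅ UA two :=
  ⟨uHomA τ, uHomA τ, WideSubcategory.hom_ext _ T.hom_inv_id, WideSubcategory.hom_ext _ T.inv_hom_id⟩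

/-- The group `{γ ∈ Aut_A(U two) | γ₀ = id}` (it contains `TA`). [cite: MochizukiFrdI2008, §0 p.18] -/
def GA : Subgroup (Aut (UA two)) where
  carrier := {γ | γ.hom.1.fst = 𝟙 _}
  mul_mem' := by
    intro γ δ hγ hδ
    change (γ * δ).hom.1.fst = 𝟙 _
    rw [Aut.Aut_mul_def, Iso.trans_hom, WideSubcategory.comp_def, CFP.comp_fst,
      show γ.hom.1.fst = 𝟙 _ from hγ, show δ.hom.1.fst = 𝟙 _ from hδ, Category.comp_id]
  one_mem' := rfl
  inv_mem' := by
    intro γ hγ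
    change γ.inv.1.fst = 𝟙 _
    have h : (γ.hom ≫ γ.inv).1.fst = 𝟙 _ := by rw [γ.hom_inv_id]; rfl
    rw [WideSubcategory.comp_def, CFP.comp_fst, show γ.hom.1.fst = 𝟙 _ from hγ, Category.id_comp] at h
    exact h

/-- **`(id, s)` is a categorical quotient in `A` of the object over `two` by `GA`** (invariant arrows have
swap-invariant, hence constant, `RB`-component and descend uniquely along `s`; the descended arrow has the
same `C₀`-component, so it is an isometry). [cite: MochizukiFrdI2008, §0 p.18] -/
theorem isCategoricalQuotient_uHomA_s : IsCategoricalQuotient GA (uHomA s) := by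
  refine ⟨fun γ hγ => WideSubcategory.hom_ext _ (CFP.hom_ext ?_ (hom_pt_ext _ _)), fun Y ψ hψ => ?_⟩
  · rw [WideSubcategory.comp_def, CFP.comp_fst, show γ.hom.1.fst = 𝟙 _ from hγ, Category.id_comp]
  · have hT : T.hom ≫ ψ.1 = ψ.1 := congrArg InducedWideCategory.Hom.hom (hψ TA rfl)
    have hc : ψ.1.snd true = ψ.1.snd false := apply_eq_of_τ_comp ψ.1.snd (congrArg CFP.Hom.snd hT)
    let g : pt ⟶ Y.obj.snd := fun _ => ψ.1.snd false
    have hsg : s ≫ g = ψ.1.snd := by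
      funext b
      rw [comp_app]
      cases b
      · rfl
      · exact hc.symm
    let ψ' : UA pt ⟶ Y := ⟨⟨ψ.1.fst, g, ψ.1.w⟩, ψ.2⟩
    refine ⟨ψ', WideSubcategory.hom_ext _ (CFP.hom_ext (Category.id_comp _) hsg), fun ψ'' h => ?_⟩
    have h' : uHom s ≫ ψ''.1 = ψ.1 := congrArg InducedWideCategory.Hom.hom h
    refine WideSubcategory.hom_ext _ (CFP.hom_ext ?_ (funext fun u => ?_))
    · have h1 := congrArg CFP.Hom.fst h'
      rw [CFP.comp_fst, uHom_fst, Category.id_comp] at h1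
      exact h1
    · have h2 : s ≫ ψ''.1.snd = ψ.1.snd := congrArg CFP.Hom.snd h'
      exact (congrFun h2 false : _)

/-- **… and it is mono-minimal**: a monomorphism `ζ` of `A` out of the object over `two` with
`ζ ≫ φ' = (id, s)` has injective `RB`-component (test against `id`, `TA`) and split-mono `C₀`-component,
so it is invertible in `C`, hence in `A`. [cite: MochizukiFrdI2008, §0 p.18] -/
theorem isMonoMinimalQuotient_uHomA_s : IsMonoMinimalQuotient GA (uHomA s) := by
  refine ⟨isCategoricalQuotient_uHomA_s, ?_⟩
  intro A' ζ φ' hζ hmono _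
  haveI := hmono
  have hne : ζ.1.snd true ≠ ζ.1.snd false := by
    intro h
    have hc : TA.hom ≫ ζ = 𝟙 _ ≫ ζ := WideSubcategory.hom_ext _
      (CFP.hom_ext rfl ((τ_comp_eq_of_apply_eq ζ.1.snd h).trans (Category.id_comp ζ.1.snd).symm))
    have hT : TA.hom = 𝟙 _ := (cancel_mono ζ).1 hc
    have h2 : τ = 𝟙 two := congrArg CFP.Hom.snd (congrArg InducedWideCategory.Hom.hom hT)
    exact Bool.false_ne_true (congrFun h2 true)
  haveI : IsIso ζ.1.snd := isIso_of_apply_ne ζ.1.snd hne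
  have hfst : ζ.1.fst ≫ φ'.1.fst = 𝟙 _ := by
    have h := congrArg CFP.Hom.fst (congrArg InducedWideCategory.Hom.hom hζ)
    rw [WideSubcategory.comp_def, CFP.comp_fst] at h
    exact h
  haveI : IsSplitMono ζ.1.fst := IsSplitMono.mk' ⟨φ'.1.fst, hfst⟩
  haveI : Epi ζ.1.fst := C0.isTotallyEpimorphic.epi ζ.1.fst
  haveI : IsIso ζ.1.fst := isIso_of_epi_of_isSplitMono ζ.1.fst
  haveI : IsIso ζ.1 := CFP.isIso_of_isIso_fst_snd ζ.1
  exact A.isIso_of_isIso_val πR ζ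

/-- **The object over `pt` is an ISO-SUBANCHOR of `A`** (via the subanchor over `two`).
[cite: MochizukiFrdI2008, §0 p.18] -/
theorem isIsoSubanchor_unit : IsIsoSubanchor (UA pt) :=
  ⟨UA two, GA, uHomA s, ⟨UA pt, isAnchor_unit, ⟨uHomA s⟩⟩, isMonoMinimalQuotient_uHomA_s⟩

/-- **… and it is ISOTROPIC in `A`** (Ex. 3.3 (iii): isotropy in `A` is isotropy in `C`).
[cite: MochizukiFrdII2008, Ex 3.3 (iii) p.29] -/
theorem isIsotropic_unit : PreFrobenioid.IsIsotropic (A.toElem πR) (UA pt) :=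
  (Ex33iii_isotropic_iff_holds πR (UA pt)).2 ArchFrd.isIsotropic_unit

end A

/-- **Proposition 3.5 (ii) for `A` FAILS over the retract base** (connected, of RC-iso-subanchor type, NOT
totally epimorphic): the isotropic object over `pt` is an iso-subanchor of `A`.
[cite: MochizukiFrdII2008, Prop 3.5 (ii) p.34] -/
theorem not_prop35ii_A_retract :
    ¬ Literature.AlgebraicGeometry.Frobenioids.ArchFrd.Prop35ii_A πR := fun h =>
  (h RB.isOfRCIsoSubanchorType (A.UA pt)).2 A.isIsoSubanchor_unit A.isIsotropic_unit

/-- **Packaged: «`D` totally epimorphic» cannot be dropped from Proposition 3.5 (ii) for `A` either.**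
[cite: MochizukiFrdII2008, Prop 3.5 (ii) p.34] -/
theorem exists_base_not_prop35ii_A :
    ∃ π : RB ⥤ D0, IsGraphConnected RB ∧ ¬ IsTotallyEpimorphic RB ∧
      RC.IsOfRCIsoSubanchorType (baseRC π) ∧
        ¬ Literature.AlgebraicGeometry.Frobenioids.ArchFrd.Prop35ii_A π :=
  ⟨πR, RB.isGraphConnected, RB.not_isTotallyEpimorphic, RB.isOfRCIsoSubanchorType, not_prop35ii_A_retract⟩

end ArchFrd
end
end Literature.AlgebraicGeometry.Frobenioids
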